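import Mathlib
import Literature.MathematicalPhysics.StatisticalMechanics.PeriodicConfigurationSums
import Summits.AtomisticToContinuum.Crystallization.Theorems.LayeredLawsSelectHcp.Negative.PeriodicPalmLaw
import Summits.AtomisticToContinuum.Crystallization.Theorems.ChargedEnergyGap.Negative.FarCopies

/-!
# FrustratedLawDichotomy · periodic sub-configurations: splitting a motif and the site sums (route-independent toolkit)
# (decomp-a2c, prover hand 2, structural share, generation 5 — groundwork for the UNCONDITIONAL periodic removal test)

For two periodic configurations `A`, `B` of `ℝ³` with the SAME lattice `Λ` as a third one `P` and motifs splitting its motif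
(`P.motif = A.motif ∪ B.motif`, disjoint), the point sets split accordingly (`points_eq_union`, `disjoint_points`), every Lennard-Jones
site sum of `P` splits (`tsum_site_split`), the site-type sum over the points of `B` seen from a point `w ∉ B.points` is the finite sum over
the motif of `B` of lattice series (`tsum_points_eq_sum_tsum_lattice`), and each lattice series is symmetric under exchanging its two base
points (`tsum_lattice_symm`).  With `twice_card_mul_energyPerParticle` (`2·#motif·e = Σ_{motif} site sum`) this is the bookkeeping behind the
sub-motif removal inequality of `FrustratedLawDichotomyPeriodicRemovalTest`.  No new definitions (sub-configurations are supplied by the user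
as structures sharing the lattice).  All `[folklore]`.
-/

noncomputable section

namespace Summit.AtomisticToContinuum.Crystallization.Theorems.FrustratedLawDichotomyPeriodicSubconfiguration

open Literature.MathematicalPhysics.StatisticalMechanics
open Summit.AtomisticToContinuum.Crystallization.Theorems.LayeredLawsSelectHcp.Negative.PeriodicPalmLaw (motifLatticeEquiv
  motifLatticeEquiv_apply_coe)

open Summit.AtomisticToContinuum.Crystallization.Theorems.ChargedEnergyGapNegative (E3)

variable (P : PeriodicConfiguration 3)

/-! ## §1. Energy per particle as a sum of site sums -/

/-- `2·#motif·e(P) = Σ_{x ∈ motif} Σ'_{y ∈ points, y ≠ x} V(dist x y)`. [folklore] -/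
theorem twice_card_mul_energyPerParticle (V : ℝ → ℝ) :
    2 * (P.motif.card : ℝ) * P.energyPerParticle V =
      ∑ x ∈ P.motif, ∑' y : {y : E3 // y ∈ P.points ∧ y ≠ x}, V (dist x y.1) := by
  unfold PeriodicConfiguration.energyPerParticle
  have hc : (2 * (P.motif.card : ℝ)) ≠ 0 := by
    have : (0 : ℝ) < P.motif.card := by exact_mod_cast P.motif_nonempty.card_pos
    positivity
  rw [← mul_assoc, mul_inv_cancel₀ hc, one_mul]

/-! ## §2. Splitting the point set along a splitting of the motif -/

section Split

variable {P}
variable {A B : PeriodicConfiguration 3} (hA : A.lattice = P.lattice) (hB : B.lattice = P.lattice)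
  (hAM : A.motif ⊆ P.motif) (hBM : B.motif ⊆ P.motif)

include hA hAM in
/-- The points of a sub-configuration are points. [folklore] -/
theorem points_subset : A.points ⊆ P.points := by
  rintro z ⟨y, hy, g, hg, rfl⟩
  exact ⟨y, hAM hy, g, by rwa [hA] at hg, rfl⟩

include hA hB hAM hBM in
/-- If the motifs cover `P.motif`, the point sets cover `P.points`. [folklore] -/
theorem points_eq_union (hcover : ∀ x ∈ P.motif, x ∈ A.motif ∨ x ∈ B.motif) : P.points = A.points ∪ B.points := by
  apply Set.Subset.antisymm
  · rintro z ⟨y, hy, g, hg, rfl⟩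
    rcases hcover y hy with h | h
    · exact Or.inl ⟨y, h, g, by rwa [hA], rfl⟩
    · exact Or.inr ⟨y, h, g, by rwa [hB], rfl⟩
  · rintro z (hz | hz)
    · exact points_subset hA hAM hz
    · exact points_subset hB hBM hz

include hA hB hAM hBM in
/-- If the motifs are disjoint, so are the point sets (motif points of `P` are pairwise inequivalent modulo `Λ`). [folklore] -/
theorem disjoint_points (hdisj : Disjoint A.motif B.motif) : Disjoint A.points B.points := by
  rw [Set.disjoint_left]
  rintro z ⟨y, hy, g, hg, rfl⟩ ⟨y', hy', g', hg', h⟩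
  have hyy : y = y' := by
    refine P.eq_of_sub_mem y (hAM hy) y' (hBM hy') ?_
    have : y - y' = g' - g := by
      rw [sub_eq_sub_iff_add_eq_add, h, add_comm]
    rw [this]
    rw [hA] at hg; rw [hB] at hg'
    exact P.lattice.sub_mem hg' hg
  exact Finset.disjoint_left.1 hdisj hy (hyy ▸ hy')

end Split

/-! ## §3. Summability and splitting of site-type sums -/

/-- Every Lennard-Jones site-type series over a subset of the points of a periodic configuration of `ℝ³` is summable. [folklore] -/
theorem summable_lennardJones_subset (w : E3) {S : Set E3} (hS : S ⊆ {y : E3 | y ∈ P.points ∧ y ≠ w}) :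
    Summable fun y : S => lennardJones (dist w y.1) := by
  have h := P.summable_lennardJones_dist_three w
  exact (h.comp_injective (Set.inclusion_injective hS)).congr fun y => rfl

/-- **Site split.**  If `P.points = A.points ∪ B.points` disjointly, every site-type series over the points of `P` (omitting `w`) is the sum of
the two series over the points of `A` and of `B`. [folklore] -/
theorem tsum_site_split {A B : PeriodicConfiguration 3} (hunion : P.points = A.points ∪ B.points) (hdisj : Disjoint A.points B.points)
    (w : E3) :
    ∑' y : {y : E3 // y ∈ P.points ∧ y ≠ w}, lennardJones (dist w y.1) =
      (∑' y : {y : E3 // y ∈ A.points ∧ y ≠ w}, lennardJones (dist w y.1)) +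
        ∑' y : {y : E3 // y ∈ B.points ∧ y ≠ w}, lennardJones (dist w y.1) := by
  have hset : {y : E3 | y ∈ P.points ∧ y ≠ w} = {y : E3 | y ∈ A.points ∧ y ≠ w} ∪ {y : E3 | y ∈ B.points ∧ y ≠ w} := by
    ext y; simp only [Set.mem_setOf_eq, Set.mem_union, hunion]; tauto
  have hd : Disjoint {y : E3 | y ∈ A.points ∧ y ≠ w} {y : E3 | y ∈ B.points ∧ y ≠ w} := by
    rw [Set.disjoint_left] at hdisj ⊢
    exact fun y hy hy' => hdisj hy.1 hy'.1
  have hSA : Summable ((fun y : E3 => lennardJones (dist w y)) ∘ (↑) : {y : E3 | y ∈ A.points ∧ y ≠ w} → ℝ) :=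
    summable_lennardJones_subset P w (fun y hy => by rw [Set.mem_setOf_eq, hunion]; exact ⟨Or.inl hy.1, hy.2⟩)
  have hSB : Summable ((fun y : E3 => lennardJones (dist w y)) ∘ (↑) : {y : E3 | y ∈ B.points ∧ y ≠ w} → ℝ) :=
    summable_lennardJones_subset P w (fun y hy => by rw [Set.mem_setOf_eq, hunion]; exact ⟨Or.inr hy.1, hy.2⟩)
  have := hSA.tsum_union_disjoint hd hSB
  rw [← tsum_congr_set_coe (fun y : E3 => lennardJones (dist w y)) hset] at this
  exact this

/-! ## §4. Orbit form of a site-type sum and its symmetry -/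

/-- Seen from a point `w` off the configuration, the clause `y ≠ w` is idle. [folklore] -/
theorem setOf_points_ne_eq {B : PeriodicConfiguration 3} {w : E3} (hw : w ∉ B.points) :
    {y : E3 | y ∈ B.points ∧ y ≠ w} = B.points := by
  ext y
  simp only [Set.mem_setOf_eq, and_iff_left_iff_imp]
  rintro hy rfl
  exact hw hy

/-- **Orbit form.**  For `w ∉ B.points`: `Σ'_{y ∈ B.points, y ≠ w} V_LJ(dist w y) = Σ_{b ∈ B.motif} Σ'_{ℓ ∈ Λ} V_LJ(dist w (b + ℓ))`
(the point set is `motif × lattice`). [folklore] -/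
theorem tsum_points_eq_sum_tsum_lattice (B : PeriodicConfiguration 3) {w : E3} (hw : w ∉ B.points) :
    ∑' y : {y : E3 // y ∈ B.points ∧ y ≠ w}, lennardJones (dist w y.1) =
      ∑ b ∈ B.motif, ∑' l : B.lattice, lennardJones (dist w (b + (l : E3))) := by
  classical
  have hsum0 : Summable fun y : {y : E3 // y ∈ B.points ∧ y ≠ w} => lennardJones (dist w y.1) :=
    B.summable_lennardJones_dist_three w
  have h1 : (∑' y : {y : E3 // y ∈ B.points ∧ y ≠ w}, lennardJones (dist w y.1)) =
      ∑' y : ↥B.points, lennardJones (dist w (y : E3)) := by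
    have := tsum_congr_set_coe (fun y : E3 => lennardJones (dist w y)) (setOf_points_ne_eq hw)
    exact this
  rw [h1]
  have hsum : Summable fun y : ↥B.points => lennardJones (dist w (y : E3)) := by
    have := (summable_lennardJones_subset B w (S := B.points) (fun y hy => ⟨hy, fun h => hw (h ▸ hy)⟩))
    exact this
  -- transport along `motif × lattice ≃ points`
  set e := motifLatticeEquiv B with he
  have hprod : Summable fun p : ↥B.motif × ↥B.lattice => lennardJones (dist w ((p.1 : E3) + (p.2 : E3))) := by
    have := (e.summable_iff (f := fun y : ↥B.points => lennardJones (dist w (y : E3)))).2 hsum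
    refine this.congr fun p => ?_
    simp only [Function.comp, he, motifLatticeEquiv_apply_coe]
  calc ∑' y : ↥B.points, lennardJones (dist w (y : E3))
      = ∑' p : ↥B.motif × ↥B.lattice, lennardJones (dist w ((e p : ↥B.points) : E3)) := (e.tsum_eq _).symm
    _ = ∑' p : ↥B.motif × ↥B.lattice, lennardJones (dist w ((p.1 : E3) + (p.2 : E3))) := by
        refine tsum_congr fun p => ?_; rw [he, motifLatticeEquiv_apply_coe]
    _ = ∑' b : ↥B.motif, ∑' l : ↥B.lattice, lennardJones (dist w ((b : E3) + (l : E3))) := hprod.tsum_prod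
    _ = ∑ b : ↥B.motif, ∑' l : ↥B.lattice, lennardJones (dist w ((b : E3) + (l : E3))) := tsum_fintype _
    _ = ∑ b ∈ B.motif, ∑' l : ↥B.lattice, lennardJones (dist w (b + (l : E3))) :=
        Finset.sum_coe_sort B.motif (fun b => ∑' l : ↥B.lattice, lennardJones (dist w (b + (l : E3))))

/-- **Symmetry of a lattice series**: `Σ'_{ℓ ∈ Λ} V(dist x (b + ℓ)) = Σ'_{ℓ ∈ Λ} V(dist b (x + ℓ))` (re-index `ℓ ↦ −ℓ`). [folklore] -/
theorem tsum_lattice_symm (L : Submodule ℤ E3) (V : ℝ → ℝ) (x b : E3) :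
    ∑' l : L, V (dist x (b + (l : E3))) = ∑' l : L, V (dist b (x + (l : E3))) := by
  let e : ↥L ≃ ↥L :=
    { toFun := fun l => ⟨-(l : E3), L.neg_mem l.2⟩
      invFun := fun l => ⟨-(l : E3), L.neg_mem l.2⟩
      left_inv := fun l => by ext1; simp
      right_inv := fun l => by ext1; simp }
  rw [← e.tsum_eq]
  refine tsum_congr fun l => ?_
  show V (dist x (b + -(l : E3))) = V (dist b (x + (l : E3)))
  congr 1
  rw [dist_eq_norm, dist_eq_norm, ← norm_neg]
  congr 1; abel

end Summit.AtomisticToContinuum.Crystallization.Theorems.FrustratedLawDichotomyPeriodicSubconfiguration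

end
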